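import Summits.CriticalPhenomena.PercolationContinuityZ3.Theorems.SahiAbsorbedSlots
import Literature.Combinatorics.Sahi2008.CycleForm

/-!
# `NoHeavyLowerTail` (crux stmt-CriticalPhenomena-4575), Sahi programme: census identities, part 3 —
# the L3-frame multiplier for ANY number of absorbing heads is a cycle polynomial

Support file (Sahi cell; `--supports stmt-CriticalPhenomena-4575`).  Mathematics and Lean text by the census seat
`prim-sahi-census` gen 4 (HOME/prim-sahi-census/HandoffIdentitiesG4.lean, rc 0, 2026-08-20), landed verbatim by the
typer seat gen 5 (parts 1–2: `SahiDisjointSlot.lean`, `SahiAbsorbedSlots.lean`).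

**`sahiE_absorbingFrame`** (every `n`, every `r`): if `E_{n+1}(x) = 0` and the heads `G_r,…,G_0` absorb every atom
of the frame `x`, with one free slot `H`, then
`E_{n+2+r+1}(G_r,…,G_0, H, x) = P_{r+1}(G)·E_{n+2}(H, x)`, where
`P_k(G) = Σ_{σ ∈ S_k} Π_{cycles B of σ} ((n+2) − E[Π_{i∈B} G_i])` is the UNSIGNED cycle sum of the lifted family on
`Option α` (value `1` at the extra point, weight `c = n+2` there and `−μ` on `α`; `liftW`, `liftF`, `frameP`), built on
the tree's Lieb–Sahi cycle form (`CycleForm.lean`).  `frameP_one`, `frameP_succ_succ` recover the census multipliers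
for `r = 1, 2`.  Ours, elementary; identities for every weight.
-/

namespace Summit.CriticalPhenomena.PercolationContinuityZ3.Theorems

namespace SahiIdentities

open MeasureTheory Finset Literature.Combinatorics.Sahi2008

noncomputable section

variable {α : Type*} [Fintype α]

/-! ### The L3-frame multiplier for ANY number `r + 1` of absorbing heads (gen 4, late): a CYCLE POLYNOMIAL

With the Lieb–Sahi cycle form now in the tree (`CycleForm`), the general multiplier is
`P_k(G) = Σ_{σ ∈ S_k} Π_{cycles B of σ} ((n+2) − E[Π_{i∈B} G_i])` — the UNSIGNED cycle sum of the lifted family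
`G̃_i` on `Option α` (value `1` at the extra point, weight `c = n+2` there and `−μ` on `α`).  -/

/-- The lifted weight on `Option α`: `c` at `none`, `−μ` on `α`. [new] -/
def liftW (μ : α → ℝ) (c : ℝ) : Option α → ℝ := fun o => o.elim c (fun a => - μ a)

/-- The lifted family: `G̃ i none = 1`, `G̃ i (some a) = G i a`. [new] -/
def liftF {κ : Type*} (G : κ → α → ℝ) : κ → Option α → ℝ := fun i o => o.elim 1 (fun a => G i a)

/-- **The frame polynomial** `P_k(G) := Σ_{σ ∈ S_k} E_σ^{lift}(G̃)` (unsigned cycle sum of the lift). [new] -/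
def frameP (μ : α → ℝ) (c : ℝ) (k : ℕ) (G : Fin k → α → ℝ) : ℝ :=
  ∑ σ : Equiv.Perm (Fin k), CycleForm.cycleE (liftW μ c) (liftF G) σ

omit [Fintype α] in
/-- The tail of a lifted family is the lift of the tail (plumbing). [this work] -/
theorem liftF_tail {k : ℕ} (G : Fin (k + 1) → α → ℝ) : Fin.tail (liftF G) = liftF (Fin.tail G) := rfl

/-- Moments of the lifted family under the lifted weight: `E_{liftW}(Π_{i∈B} G̃_i) = c − E(Π_{i∈B} G_i)`. [this work] -/
theorem ex_liftW_prod (μ : α → ℝ) (c : ℝ) {κ : Type*} (G : κ → α → ℝ) (B : Finset κ) :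
    ex (liftW μ c) (fun o => ∏ i ∈ B, liftF G i o) = c - ex μ (fun a => ∏ i ∈ B, G i a) := by
  simp only [ex, Fintype.sum_option, liftW, liftF, Option.elim]
  simp [Finset.prod_const_one, neg_mul, Finset.sum_neg_distrib, sub_eq_add_neg]

/-- First moments of the lifted family: `E_{liftW}(G̃_i) = c − E(G_i)`. [this work] -/
theorem ex_liftW_liftF (μ : α → ℝ) (c : ℝ) {κ : Type*} (G : κ → α → ℝ) (i : κ) :
    ex (liftW μ c) (liftF G i) = c - ex μ (G i) := by
  simp only [ex, Fintype.sum_option, liftW, liftF, Option.elim]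
  simp [neg_mul, Finset.sum_neg_distrib, sub_eq_add_neg]

/-- **Closed form**: `P_k(G) = Σ_σ Π_{B ∈ cycles σ} (c − E[Π_{i∈B} G_i])`. [new] -/
theorem frameP_eq (μ : α → ℝ) (c : ℝ) (k : ℕ) (G : Fin k → α → ℝ) :
    frameP μ c k G = ∑ σ : Equiv.Perm (Fin k), ∏ B ∈ CycleForm.orbits σ, (c - ex μ (fun a => ∏ i ∈ B, G i a)) := by
  unfold frameP CycleForm.cycleE
  refine Finset.sum_congr rfl fun σ _ => Finset.prod_congr rfl fun B _ => ?_
  exact ex_liftW_prod μ c G B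

/-- `P_1(G) = c − E G_0`. [new] -/
theorem frameP_one (μ : α → ℝ) (c : ℝ) (G : Fin 1 → α → ℝ) : frameP μ c 1 G = c - ex μ (G 0) := by
  rw [frameP_eq, Fintype.sum_unique]
  have horb : CycleForm.orbits (default : Equiv.Perm (Fin 1)) = {{0}} := by
    unfold CycleForm.orbits
    rw [Finset.univ_unique, Finset.image_singleton]
    congr 1
  rw [horb, Finset.prod_singleton]
  simp

/-- **Insertion recursion** (peel head `0`): `P_{k+2}(G) = (c − E G_0)·P_{k+1}(tail G) + Σ_e P_{k+1}(tail G with slot e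
multiplied by G_0)` — `decomposeFin` on `σ(0)`, via `CycleForm.cycleE_decomposeFin_zero/succ`. [new] -/
theorem frameP_succ_succ (μ : α → ℝ) (c : ℝ) (k : ℕ) (G : Fin (k + 2) → α → ℝ) :
    frameP μ c (k + 2) G = (c - ex μ (G 0)) * frameP μ c (k + 1) (Fin.tail G) +
      ∑ e : Fin (k + 1), frameP μ c (k + 1) (Function.update (Fin.tail G) e (Fin.tail G e * G 0)) := by
  unfold frameP
  rw [← Equiv.sum_comp Equiv.Perm.decomposeFin.symm, Fintype.sum_prod_type, Fin.sum_univ_succ]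
  congr 1
  · rw [Finset.mul_sum]
    refine Finset.sum_congr rfl fun τ _ => ?_
    rw [CycleForm.cycleE_decomposeFin_zero, ex_liftW_liftF, liftF_tail]
  · refine Finset.sum_congr rfl fun e _ => Finset.sum_congr rfl fun τ _ => ?_
    rw [CycleForm.cycleE_decomposeFin_succ, liftF_tail]
    congr 1
    funext i o
    by_cases h : i = e
    · subst h
      simp only [liftF, Function.update_self, Fin.tail, Pi.mul_apply]
      cases o <;> simp
    · simp only [liftF, Function.update_of_ne h]

omit [Fintype α] in
/-- Reversal turns head-peeling into last-peeling: `G ∘ rev = snoc (tail G ∘ rev) (G 0)`. [folklore] -/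
theorem comp_rev_eq_snoc {β : Type*} {k : ℕ} (G : Fin (k + 2) → β) :
    (G ∘ Fin.rev : Fin (k + 2) → β) = Fin.snoc (Fin.tail G ∘ Fin.rev : Fin (k + 1) → β) (G 0) := by
  funext j
  refine Fin.lastCases ?_ (fun i => ?_) j
  · rw [Fin.snoc_last, Function.comp_apply, Fin.rev_last]
  · rw [Fin.snoc_castSucc, Function.comp_apply, Function.comp_apply, Fin.rev_castSucc]
    rfl

omit [Fintype α] in
/-- Updating a left slot of `Fin.append`. [folklore] -/
theorem update_append_castAdd {β : Type*} {a b : ℕ} (v : Fin a → β) (w : Fin b → β) (i : Fin a) (y : β) :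
    Function.update (Fin.append v w) (Fin.castAdd b i) y = Fin.append (Function.update v i y) w := by
  funext k
  refine Fin.addCases (fun i' => ?_) (fun e' => ?_) k
  · rw [Fin.append_left]
    by_cases h : i' = i
    · subst h; rw [Function.update_self, Function.update_self]
    · rw [Function.update_of_ne (fun h' => h (Fin.castAdd_inj.1 h')), Function.update_of_ne h, Fin.append_left]
  · rw [Fin.append_right, Function.update_of_ne, Fin.append_right]
    intro h'
    have := congrArg Fin.val h'
    simp at this
    omega

omit [Fintype α] in
/-- Updating a right slot of `Fin.append`. [folklore] -/
theorem update_append_natAdd {β : Type*} {a b : ℕ} (v : Fin a → β) (w : Fin b → β) (e : Fin b) (y : β) :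
    Function.update (Fin.append v w) (Fin.natAdd a e) y = Fin.append v (Function.update w e y) := by
  funext k
  refine Fin.addCases (fun i' => ?_) (fun e' => ?_) k
  · rw [Fin.append_left, Function.update_of_ne, Fin.append_left]
    intro h'
    have := congrArg Fin.val h'
    simp at this
    omega
  · rw [Fin.append_right]
    by_cases h : e' = e
    · subst h; rw [Function.update_self, Function.update_self]
    · rw [Function.update_of_ne (fun h' => h (Fin.natAdd_inj _ |>.1 h')), Function.update_of_ne h, Fin.append_right]

omit [Fintype α] in
/-- Updating the head of a `vecCons` (plumbing). [this work] -/
theorem update_vecCons_zero {β : Type*} {m : ℕ} (h y : β) (x : Fin m → β) :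
    Function.update (Matrix.vecCons h x) 0 y = Matrix.vecCons y x := by
  funext i
  refine Fin.cases ?_ (fun j => ?_) i
  · rw [Function.update_self, Matrix.cons_val_zero]
  · rw [Function.update_of_ne (Fin.succ_ne_zero j), Matrix.cons_val_succ, Matrix.cons_val_succ]

/-- **(L3-frame, GENERAL `r + 1` heads), every `n`.**  If `E_{n+1}(x) = 0` and each `G_i` absorbs every `x_j`, then
`E_{n+2+r+1}(H, x, G_r, …, G_0) = P_{r+1}(G) · E_{n+2}(H, x)` with `P` the frame polynomial (`frameP_eq`:
`Σ_{σ∈S_{r+1}} Π_{cycles B} ((n+2) − E[Π_{i∈B} G_i])`); `r = 0, 1` are `sahiE_absorbingFrame_one/two` up to slot order.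
Proof: peel the last slot (`sahiE_snoc`), split the slot sum into the frame part (`H ↦ H·G_0` is invisible by
`sahiE_cons_mul_absorbing_eq`, each `x_j ↦ x_j·G_0 = x_j`) and the head part (induction), and close with the insertion
recursion `frameP_succ_succ`. [new] -/
theorem sahiE_absorbingFrame (μ : α → ℝ) (n : ℕ) (x : Fin (n + 1) → α → ℝ) (hx0 : sahiE μ (n + 1) x = 0) :
    ∀ (r : ℕ) (G : Fin (r + 1) → α → ℝ) (H : α → ℝ), (∀ i j, x j * G i = x j) →
      sahiE μ (n + 2 + r + 1) (Fin.append (Matrix.vecCons H x) (G ∘ Fin.rev) : Fin (n + 2 + (r + 1)) → α → ℝ) =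
        frameP μ (n + 2) (r + 1) G * sahiE μ (n + 2) (Matrix.vecCons H x) := by
  intro r
  induction r with
  | zero =>
    intro G H hG
    have happ : (Fin.append (Matrix.vecCons H x) (G ∘ Fin.rev) : Fin (n + 2 + 1) → α → ℝ) =
        Fin.snoc (Matrix.vecCons H x) (G 0) := by
      rw [Fin.append_right_eq_snoc]
      rfl
    rw [happ, sahiE_snoc, frameP_one, Fin.sum_univ_succ]
    have h0 : Function.update (Matrix.vecCons H x) 0 (Matrix.vecCons H x 0 * G 0) = Matrix.vecCons (H * G 0) x := by
      rw [Matrix.cons_val_zero, update_vecCons_zero]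
    have hs : ∀ j : Fin (n + 1), Function.update (Matrix.vecCons H x) j.succ (Matrix.vecCons H x j.succ * G 0) =
        Matrix.vecCons H x := fun j =>
      Function.update_eq_self_iff.2 (by rw [Matrix.cons_val_succ, hG 0 j])
    rw [h0, sahiE_cons_mul_absorbing_eq μ n H (G 0) x hx0 (hG 0)]
    simp only [hs, Finset.sum_const, Finset.card_univ, Fintype.card_fin, nsmul_eq_mul]
    push_cast
    ring
  | succ r ih =>
    intro G H hG
    set G' : Fin (r + 1) → α → ℝ := Fin.tail G with hG'
    have hG't : ∀ i j, x j * G' i = x j := fun i j => hG i.succ j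
    set v : Fin (n + 2) → α → ℝ := Matrix.vecCons H x with hv
    set g : Fin (n + 2 + (r + 1)) → α → ℝ := Fin.append v (G' ∘ Fin.rev) with hg
    have happ : (Fin.append v (G ∘ Fin.rev) : Fin (n + 2 + (r + 2)) → α → ℝ) = Fin.snoc g (G 0) := by
      rw [comp_rev_eq_snoc, Fin.append_snoc]
    have key := sahiE_snoc μ (n + 2 + r) g (G 0)
    rw [happ]
    refine key.trans ?_
    -- the inner value
    have hin : sahiE μ (n + 2 + r + 1) g = frameP μ (n + 2) (r + 1) G' * sahiE μ (n + 2) v := ih G' H hG't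
    -- split the slot sum: frame slots (castAdd) and head slots (natAdd)
    have hsplit : (∑ i : Fin (n + 2 + r + 1), sahiE μ (n + 2 + r + 1) (Function.update g i (g i * G 0))) =
        (∑ i : Fin (n + 2), sahiE μ (n + 2 + r + 1) (Function.update g (Fin.castAdd (r + 1) i) (g (Fin.castAdd (r + 1) i) * G 0))) +
        ∑ e : Fin (r + 1), sahiE μ (n + 2 + r + 1) (Function.update g (Fin.natAdd (n + 2) e) (g (Fin.natAdd (n + 2) e) * G 0)) :=
      Fin.sum_univ_add (a := n + 2) (b := r + 1) _
    rw [hsplit, hin]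
    -- frame slots
    have hframe : ∀ i : Fin (n + 2), sahiE μ (n + 2 + r + 1)
        (Function.update g (Fin.castAdd (r + 1) i) (g (Fin.castAdd (r + 1) i) * G 0)) =
        frameP μ (n + 2) (r + 1) G' * sahiE μ (n + 2) v := by
      intro i
      rw [hg, Fin.append_left, update_append_castAdd]
      refine Fin.cases ?_ (fun j => ?_) i
      · rw [hv, Matrix.cons_val_zero, update_vecCons_zero, ih G' (H * G 0) hG't,
          sahiE_cons_mul_absorbing_eq μ n H (G 0) x hx0 (hG 0)]
      · have : Function.update v j.succ (v j.succ * G 0) = v :=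
          Function.update_eq_self_iff.2 (by rw [hv, Matrix.cons_val_succ, hG 0 j])
        rw [this, ih G' H hG't]
    -- head slots
    have hhead : ∀ e : Fin (r + 1), sahiE μ (n + 2 + r + 1)
        (Function.update g (Fin.natAdd (n + 2) e) (g (Fin.natAdd (n + 2) e) * G 0)) =
        frameP μ (n + 2) (r + 1) (Function.update G' (Fin.rev e) (G' (Fin.rev e) * G 0)) * sahiE μ (n + 2) v := by
      intro e
      rw [hg, Fin.append_right, update_append_natAdd, Function.comp_apply]
      have hu : Function.update (G' ∘ Fin.rev) e (G' (Fin.rev e) * G 0) =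
          Function.update G' (Fin.rev e) (G' (Fin.rev e) * G 0) ∘ Fin.rev :=
        (Function.update_comp_eq_of_injective G' Fin.rev_injective e _).symm
      rw [hu]
      refine ih _ H fun i j => ?_
      by_cases hi : i = Fin.rev e
      · subst hi; rw [Function.update_self, ← mul_assoc, hG't, hG 0 j]
      · rw [Function.update_of_ne hi]; exact hG't i j
    simp only [hframe, hhead, Finset.sum_const, Finset.card_univ, Fintype.card_fin, nsmul_eq_mul]
    have hrev : (∑ e : Fin (r + 1), frameP μ (n + 2) (r + 1) (Function.update G' (Fin.rev e) (G' (Fin.rev e) * G 0)) * sahiE μ (n + 2) v) =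
        ∑ e : Fin (r + 1), frameP μ (n + 2) (r + 1) (Function.update G' e (G' e * G 0)) * sahiE μ (n + 2) v :=
      Fintype.sum_equiv Fin.revPerm _ _ (fun e => rfl)
    rw [hrev, frameP_succ_succ, ← hG', ← Finset.sum_mul]
    push_cast
    ring

/-- Consistency with the `r = 1` entry of the catalogue: `P_2(G) = (c − E G_0G_1) + (c − E G_0)(c − E G_1)`. [new] -/
example (μ : α → ℝ) (c : ℝ) (G : Fin 2 → α → ℝ) :
    frameP μ c 2 G = (c - ex μ (G 1 * G 0)) + (c - ex μ (G 0)) * (c - ex μ (G 1)) := by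
  rw [frameP_succ_succ, frameP_one, Fin.sum_univ_one, frameP_one]
  simp only [Fin.tail, Function.update_self, Fin.succ_zero_eq_one]
  ring

end

end SahiIdentities

end Summit.CriticalPhenomena.PercolationContinuityZ3.Theorems
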